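import Summits.Ventures.CertifiedManyBodySolver.Certificates.EmeryCu4O8_kryFam_Hg1223IP_c0ll
import Summits.Ventures.CertifiedManyBodySolver.Certificates.EmeryCu4O8_kryFam_NdNiO2_c0ll
import Summits.Ventures.CertifiedManyBodySolver.Certificates.EmeryCu4O8_kryFam_SLCO_c0ll
import Summits.Ventures.CertifiedManyBodySolver.Downfold.EmeryBoxesInfiniteLayer
import Summits.Ventures.CertifiedManyBodySolver.Downfold.EmeryBoxesKSlicesT
import Summits.Ventures.CertifiedManyBodySolver.Downfold.EmeryBoxesTrilayer
import Summits.Ventures.CertifiedManyBodySolver.Downfold.EmeryThermalSeam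
import HarnessLib

/-!
# `T > 0` RAYLEIGH-FAMILY PRESSURE FLOORS WITH THE ENTROPY TERM: NdNiO₂ (first nickelate `T > 0` word), Sr₀.₉La₀.₁CuO₂ (first electron-doped), HgBa₂Ca₂Cu₃O₈ inner plane (first trilayer) — every β ≥ 0, levels εp = −48/5 and −31/4

Venture CertifiedManyBodySolver, cell `pub/hubbard-downfold` (S1 = ROUTER) × crew hubbard-fast S2 (ii)/(iv) «multi-band × T > 0»; seat hubbard-downfold-mod-4 (S1/S2 Emery seam).
Namespace `Summit.Ventures.CertifiedManyBodySolver.Downfold`. THE NEXT RUNG after `EmeryBoxesLa214ThermalFloorWord` (p645493, ONE vector ⇒ no entropy): hubbard-box-p2 g15's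
KLDL-R FAMILY certificates `kryFam_<box>_<corner>` (members in distinct particle-number sectors, EXACTLY orthonormal — `…_orthonormal` — with exact rational traces
`…_traces`) are fed to this seat's door `holdsOn_emeryCellPressureFloor_of_rayleighTraces` (`EmeryThermalSeam`): for every β ≥ 0 and on the whole typed box,
`¼·log Σᵢ exp(−β·Cᵢ) ≤ P_cell(β, θ_εp(p))`, `Cᵢ` = the closed-form six-box bound (`affineCapBound`, evaluated by `norm_num [max_def]`, rounded UP at 6 dp) of member i's
affine Rayleigh quotient at reference level εp (`Cᵢ(εp) = Cᵢ(0) + Nᵢ·εp`). Per box and level the family with the smallest `min Cᵢ` is used (all families' constants are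
in the theorem docstrings' neighbourhood: see the seat's EMERY-WORDS table). Two corollaries each: the best-sector linear floor and the `log k` entropy floor.

* NdNiO2 @ εp = -48/5: family `c0ll`, N = [19, 20], C = [-137.317796, -138.390248]; all families (min C): { c0ll: -138.39, c1hl: -138.184, c2lh: -138.328, c3hh: -138.094 }
* NdNiO2 @ εp = -31/4: family `c0ll`, N = [19, 20], C = [-102.167796, -101.390248]; all families (min C): { c0ll: -102.168, c1hl: -101.984, c2lh: -102.101, c3hh: -101.906 }
* SLCO @ εp = -48/5: family `c0ll`, N = [20, 21], C = [-134.670811, -131.579858]; all families (min C): { c0ll: -134.671, c1hl: -134.628, c2lh: -134.64 }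
* SLCO @ εp = -31/4: family `c0ll`, N = [20, 21], C = [-97.670811, -92.729858]; all families (min C): { c0ll: -97.671, c1hl: -97.628, c2lh: -97.64 }
* Hg1223IP @ εp = -48/5: family `c0ll`, N = [19, 20], C = [-143.161114, -144.401804]; all families (min C): { c0ll: -144.402, c1hl: -144.154 }
* Hg1223IP @ εp = -31/4: family `c0ll`, N = [19, 20], C = [-108.011114, -107.401804]; all families (min C): { c0ll: -108.011, c1hl: -107.784 }

Everything PROVED (0 sorry); no definition. HONEST FRAMING: CERTIFIED inequalities on SCREENING/EXTRAPOLATED-grade objects; trial (Gibbs–Peierls) floors on the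
grand potential from 2–3 cluster sectors — a rung of the `T > 0` ladder, not an equation of state; the reference level εp is the consumer's choice (two printed);
no phase word; no router number moves.
-/

noncomputable section

namespace Summit.Ventures.CertifiedManyBodySolver.Downfold

open NonemptyInterval Matrix Finset Literature.Probability.LatticeModels
open Literature.MathematicalPhysics.QuantumLattice Literature.Computation.Certificates ClusterLowerBound
open Summit.Ventures.CertifiedManyBodySolver.Certificates
open scoped BigOperators ComplexOrder

/-! ### NdNiO₂ (#21) U-slice of record (nickelate; n_holes 1.09) — level εp = -48/5 (μ = 48/5 eV): best family `c0ll` (members N = 19, 20) -/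

/-- Closed-form box bound of member 0 (`kry_NdNiO2_c0ll_s9x10`, N = 19) of the family at εp = -48/5: `≤ -34329449/250000` (-137.317796; cluster units, 4 cells). [folklore] -/
theorem ndNiO2Fam_c0ll_m48o5_cap0 :
    affineCapBound cuprateSigns (fun a => ((kryFam_NdNiO2_c0ll_S 0 a : ℤ) : ℝ) / ((kryFam_NdNiO2_c0ll_NN 0 : ℤ) : ℝ)) (emeryLo (-48/5) ndNiO2YK26Emery_tpd ndNiO2YK26Emery_tpp ndNiO2Dxy459YK26Emery_Delta ndNiO2Dxy459YK26Emery_Udd ndNiO2Dxy459YK26Emery_Upp) (emeryHi (-48/5) ndNiO2YK26Emery_tpd ndNiO2YK26Emery_tpp ndNiO2Dxy459YK26Emery_Delta ndNiO2Dxy459YK26Emery_Udd ndNiO2Dxy459YK26Emery_Upp) ≤ (-34329449/250000 : ℝ) := by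
  simp only [kryFam_NdNiO2_c0ll_S, kryFam_NdNiO2_c0ll_NN, affineCapBound, emeryLo, emeryHi, lineCoeff, kry_NdNiO2_c0ll_s9x10_S, cuprateSigns, ndNiO2YK26Emery_tpd, ndNiO2YK26Emery_tpp, ndNiO2Dxy459YK26Emery_Delta, ndNiO2Dxy459YK26Emery_Udd, ndNiO2Dxy459YK26Emery_Upp,
    Entry.encl_ofEnds_fst, Entry.encl_ofEnds_snd, Fin.sum_univ_succ, Fin.sum_univ_zero,
    Matrix.cons_val_zero, Matrix.cons_val_one, Matrix.cons_val_two, Matrix.cons_val, Matrix.head_cons, Matrix.tail_cons]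
  push_cast
  norm_num [max_def]

/-- Closed-form box bound of member 1 (`kry_NdNiO2_c0ll_s10x10`, N = 20) of the family at εp = -48/5: `≤ -17298781/125000` (-138.390248; cluster units, 4 cells). [folklore] -/
theorem ndNiO2Fam_c0ll_m48o5_cap1 :
    affineCapBound cuprateSigns (fun a => ((kryFam_NdNiO2_c0ll_S 1 a : ℤ) : ℝ) / ((kryFam_NdNiO2_c0ll_NN 1 : ℤ) : ℝ)) (emeryLo (-48/5) ndNiO2YK26Emery_tpd ndNiO2YK26Emery_tpp ndNiO2Dxy459YK26Emery_Delta ndNiO2Dxy459YK26Emery_Udd ndNiO2Dxy459YK26Emery_Upp) (emeryHi (-48/5) ndNiO2YK26Emery_tpd ndNiO2YK26Emery_tpp ndNiO2Dxy459YK26Emery_Delta ndNiO2Dxy459YK26Emery_Udd ndNiO2Dxy459YK26Emery_Upp) ≤ (-17298781/125000 : ℝ) := by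
  simp only [kryFam_NdNiO2_c0ll_S, kryFam_NdNiO2_c0ll_NN, affineCapBound, emeryLo, emeryHi, lineCoeff, kry_NdNiO2_c0ll_s10x10_S, cuprateSigns, ndNiO2YK26Emery_tpd, ndNiO2YK26Emery_tpp, ndNiO2Dxy459YK26Emery_Delta, ndNiO2Dxy459YK26Emery_Udd, ndNiO2Dxy459YK26Emery_Upp,
    Entry.encl_ofEnds_fst, Entry.encl_ofEnds_snd, Fin.sum_univ_succ, Fin.sum_univ_zero,
    Matrix.cons_val_zero, Matrix.cons_val_one, Matrix.cons_val_two, Matrix.cons_val, Matrix.head_cons, Matrix.tail_cons]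
  push_cast
  norm_num [max_def]

/-- **`T > 0` FAMILY FLOOR** on the whole `emeryBoxNdNiO2Dxy459YK26`, cuprate signs, level εp = -48/5, EVERY β ≥ 0:
`¼·log(Σᵢ exp(−β·Cᵢ)) ≤ P_cell(β, θ_εp(p))` with `C = (-34329449/250000, -17298781/125000)` = the closed-form box bounds of the 2 orthonormal members
(sectors N = 19, 20) of hubbard-box-p2's KLDL-R family `kryFam_NdNiO2_c0ll` — the log-sum-exp keeps the ENTROPY of the 2 sectors.
[cite: Ruelle1969, §2.5–2.6] [cite: Israel1979, Lemma II.3.1] -/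
theorem emeryBoxNdNiO2Dxy459YK26_pressureFloorFam_m48o5 {β : ℝ} (hβ : 0 ≤ β) :
    HoldsOn (fun p : EmeryCoord → ℝ =>
      Real.log (Real.exp (-(β * (-34329449/250000 : ℝ))) + Real.exp (-(β * (-17298781/125000 : ℝ)))) / 4 ≤ emeryCellPressure β (emeryLine cuprateSigns (emeryLineCoords (((-48/5 : ℚ)) : ℝ) p))) emeryBoxNdNiO2Dxy459YK26 := by
  have h := holdsOn_emeryCellPressureFloor_of_rayleighTraces (E := emeryBoxNdNiO2Dxy459YK26) (εp := -48/5) (eA := ndNiO2YK26Emery_tpd) (eB := ndNiO2YK26Emery_tpp) (eD := ndNiO2Dxy459YK26Emery_Delta)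
    (eUd := ndNiO2Dxy459YK26Emery_Udd) (eUp := ndNiO2Dxy459YK26Emery_Upp) (by simp [emeryBoxNdNiO2Dxy459YK26, emeryBoxNdNiO2Dxy459YK26Src, Function.update]) (by simp [emeryBoxNdNiO2Dxy459YK26, emeryBoxNdNiO2Dxy459YK26Src, Function.update]) (Function.update_self _ _ _) (by simp [emeryBoxNdNiO2Dxy459YK26, emeryBoxNdNiO2Dxy459YK26Src, Function.update]) (by simp [emeryBoxNdNiO2Dxy459YK26, emeryBoxNdNiO2Dxy459YK26Src, Function.update]) cuprateSigns hβ
    (φ := fun i => ((kryFam_NdNiO2_c0ll i).unit : Fock (Orb (Fin 1 ×ₗ Fin 12)))) kryFam_NdNiO2_c0ll_orthonormal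
    (T := fun i a => ((kryFam_NdNiO2_c0ll_S i a : ℤ) : ℝ) / ((kryFam_NdNiO2_c0ll_NN i : ℤ) : ℝ)) kryFam_NdNiO2_c0ll_traces
  intro p hp
  have h' := h p hp
  simp only [Fin.sum_univ_two] at h'
  refine le_trans ?_ h'
  exact div_le_div_of_nonneg_right (Real.log_le_log (by positivity) (add_le_add (Real.exp_le_exp.2 (neg_le_neg (mul_le_mul_of_nonneg_left ndNiO2Fam_c0ll_m48o5_cap0 hβ))) (Real.exp_le_exp.2 (neg_le_neg (mul_le_mul_of_nonneg_left ndNiO2Fam_c0ll_m48o5_cap1 hβ))))) (by norm_num)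

/-- **Entropy corollary** (all 2 sectors at the worst bound): `(log 2 − β·(-34329449/250000))/4 ≤ P_cell` on the whole box, every β ≥ 0 — at β = 0 this is the exact
count `¼·log 2` of the family. [cite: Ruelle1969, §2.5–2.6] -/
theorem emeryBoxNdNiO2Dxy459YK26_pressureFloorFam_m48o5_entropy {β : ℝ} (hβ : 0 ≤ β) :
    HoldsOn (fun p : EmeryCoord → ℝ =>
      (Real.log 2 - β * (-34329449/250000 : ℝ)) / 4 ≤ emeryCellPressure β (emeryLine cuprateSigns (emeryLineCoords (((-48/5 : ℚ)) : ℝ) p))) emeryBoxNdNiO2Dxy459YK26 := by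
  intro p hp
  refine le_trans ?_ (emeryBoxNdNiO2Dxy459YK26_pressureFloorFam_m48o5 hβ p hp)
  refine div_le_div_of_nonneg_right ?_ (by norm_num)
  have hk : Real.log 2 - β * (-34329449/250000 : ℝ) = Real.log (2 * Real.exp (-(β * (-34329449/250000 : ℝ)))) := by
    rw [Real.log_mul (by norm_num) (Real.exp_pos _).ne', Real.log_exp]; ring
  rw [hk]
  refine Real.log_le_log (by positivity) ?_
  have e := fun (c : ℝ) (hc : c ≤ (-34329449/250000 : ℝ)) => Real.exp_le_exp.2 (neg_le_neg (mul_le_mul_of_nonneg_left hc hβ))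
  nlinarith [e (-34329449/250000 : ℝ) (by norm_num), e (-17298781/125000 : ℝ) (by norm_num)]

/-! ### NdNiO₂ (#21) U-slice of record (nickelate; n_holes 1.09) — level εp = -31/4 (μ = 31/4 eV): best family `c0ll` (members N = 19, 20) -/

/-- Closed-form box bound of member 0 (`kry_NdNiO2_c0ll_s9x10`, N = 19) of the family at εp = -31/4: `≤ -25541949/250000` (-102.167796; cluster units, 4 cells). [folklore] -/
theorem ndNiO2Fam_c0ll_m31o4_cap0 :
    affineCapBound cuprateSigns (fun a => ((kryFam_NdNiO2_c0ll_S 0 a : ℤ) : ℝ) / ((kryFam_NdNiO2_c0ll_NN 0 : ℤ) : ℝ)) (emeryLo (-31/4) ndNiO2YK26Emery_tpd ndNiO2YK26Emery_tpp ndNiO2Dxy459YK26Emery_Delta ndNiO2Dxy459YK26Emery_Udd ndNiO2Dxy459YK26Emery_Upp) (emeryHi (-31/4) ndNiO2YK26Emery_tpd ndNiO2YK26Emery_tpp ndNiO2Dxy459YK26Emery_Delta ndNiO2Dxy459YK26Emery_Udd ndNiO2Dxy459YK26Emery_Upp) ≤ (-25541949/250000 : ℝ) := by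
  simp only [kryFam_NdNiO2_c0ll_S, kryFam_NdNiO2_c0ll_NN, affineCapBound, emeryLo, emeryHi, lineCoeff, kry_NdNiO2_c0ll_s9x10_S, cuprateSigns, ndNiO2YK26Emery_tpd, ndNiO2YK26Emery_tpp, ndNiO2Dxy459YK26Emery_Delta, ndNiO2Dxy459YK26Emery_Udd, ndNiO2Dxy459YK26Emery_Upp,
    Entry.encl_ofEnds_fst, Entry.encl_ofEnds_snd, Fin.sum_univ_succ, Fin.sum_univ_zero,
    Matrix.cons_val_zero, Matrix.cons_val_one, Matrix.cons_val_two, Matrix.cons_val, Matrix.head_cons, Matrix.tail_cons]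
  push_cast
  norm_num [max_def]

/-- Closed-form box bound of member 1 (`kry_NdNiO2_c0ll_s10x10`, N = 20) of the family at εp = -31/4: `≤ -12673781/125000` (-101.390248; cluster units, 4 cells). [folklore] -/
theorem ndNiO2Fam_c0ll_m31o4_cap1 :
    affineCapBound cuprateSigns (fun a => ((kryFam_NdNiO2_c0ll_S 1 a : ℤ) : ℝ) / ((kryFam_NdNiO2_c0ll_NN 1 : ℤ) : ℝ)) (emeryLo (-31/4) ndNiO2YK26Emery_tpd ndNiO2YK26Emery_tpp ndNiO2Dxy459YK26Emery_Delta ndNiO2Dxy459YK26Emery_Udd ndNiO2Dxy459YK26Emery_Upp) (emeryHi (-31/4) ndNiO2YK26Emery_tpd ndNiO2YK26Emery_tpp ndNiO2Dxy459YK26Emery_Delta ndNiO2Dxy459YK26Emery_Udd ndNiO2Dxy459YK26Emery_Upp) ≤ (-12673781/125000 : ℝ) := by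
  simp only [kryFam_NdNiO2_c0ll_S, kryFam_NdNiO2_c0ll_NN, affineCapBound, emeryLo, emeryHi, lineCoeff, kry_NdNiO2_c0ll_s10x10_S, cuprateSigns, ndNiO2YK26Emery_tpd, ndNiO2YK26Emery_tpp, ndNiO2Dxy459YK26Emery_Delta, ndNiO2Dxy459YK26Emery_Udd, ndNiO2Dxy459YK26Emery_Upp,
    Entry.encl_ofEnds_fst, Entry.encl_ofEnds_snd, Fin.sum_univ_succ, Fin.sum_univ_zero,
    Matrix.cons_val_zero, Matrix.cons_val_one, Matrix.cons_val_two, Matrix.cons_val, Matrix.head_cons, Matrix.tail_cons]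
  push_cast
  norm_num [max_def]

/-- **`T > 0` FAMILY FLOOR** on the whole `emeryBoxNdNiO2Dxy459YK26`, cuprate signs, level εp = -31/4, EVERY β ≥ 0:
`¼·log(Σᵢ exp(−β·Cᵢ)) ≤ P_cell(β, θ_εp(p))` with `C = (-25541949/250000, -12673781/125000)` = the closed-form box bounds of the 2 orthonormal members
(sectors N = 19, 20) of hubbard-box-p2's KLDL-R family `kryFam_NdNiO2_c0ll` — the log-sum-exp keeps the ENTROPY of the 2 sectors.
[cite: Ruelle1969, §2.5–2.6] [cite: Israel1979, Lemma II.3.1] -/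
theorem emeryBoxNdNiO2Dxy459YK26_pressureFloorFam_m31o4 {β : ℝ} (hβ : 0 ≤ β) :
    HoldsOn (fun p : EmeryCoord → ℝ =>
      Real.log (Real.exp (-(β * (-25541949/250000 : ℝ))) + Real.exp (-(β * (-12673781/125000 : ℝ)))) / 4 ≤ emeryCellPressure β (emeryLine cuprateSigns (emeryLineCoords (((-31/4 : ℚ)) : ℝ) p))) emeryBoxNdNiO2Dxy459YK26 := by
  have h := holdsOn_emeryCellPressureFloor_of_rayleighTraces (E := emeryBoxNdNiO2Dxy459YK26) (εp := -31/4) (eA := ndNiO2YK26Emery_tpd) (eB := ndNiO2YK26Emery_tpp) (eD := ndNiO2Dxy459YK26Emery_Delta)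
    (eUd := ndNiO2Dxy459YK26Emery_Udd) (eUp := ndNiO2Dxy459YK26Emery_Upp) (by simp [emeryBoxNdNiO2Dxy459YK26, emeryBoxNdNiO2Dxy459YK26Src, Function.update]) (by simp [emeryBoxNdNiO2Dxy459YK26, emeryBoxNdNiO2Dxy459YK26Src, Function.update]) (Function.update_self _ _ _) (by simp [emeryBoxNdNiO2Dxy459YK26, emeryBoxNdNiO2Dxy459YK26Src, Function.update]) (by simp [emeryBoxNdNiO2Dxy459YK26, emeryBoxNdNiO2Dxy459YK26Src, Function.update]) cuprateSigns hβ
    (φ := fun i => ((kryFam_NdNiO2_c0ll i).unit : Fock (Orb (Fin 1 ×ₗ Fin 12)))) kryFam_NdNiO2_c0ll_orthonormal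
    (T := fun i a => ((kryFam_NdNiO2_c0ll_S i a : ℤ) : ℝ) / ((kryFam_NdNiO2_c0ll_NN i : ℤ) : ℝ)) kryFam_NdNiO2_c0ll_traces
  intro p hp
  have h' := h p hp
  simp only [Fin.sum_univ_two] at h'
  refine le_trans ?_ h'
  exact div_le_div_of_nonneg_right (Real.log_le_log (by positivity) (add_le_add (Real.exp_le_exp.2 (neg_le_neg (mul_le_mul_of_nonneg_left ndNiO2Fam_c0ll_m31o4_cap0 hβ))) (Real.exp_le_exp.2 (neg_le_neg (mul_le_mul_of_nonneg_left ndNiO2Fam_c0ll_m31o4_cap1 hβ))))) (by norm_num)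

/-- **Entropy corollary** (all 2 sectors at the worst bound): `(log 2 − β·(-12673781/125000))/4 ≤ P_cell` on the whole box, every β ≥ 0 — at β = 0 this is the exact
count `¼·log 2` of the family. [cite: Ruelle1969, §2.5–2.6] -/
theorem emeryBoxNdNiO2Dxy459YK26_pressureFloorFam_m31o4_entropy {β : ℝ} (hβ : 0 ≤ β) :
    HoldsOn (fun p : EmeryCoord → ℝ =>
      (Real.log 2 - β * (-12673781/125000 : ℝ)) / 4 ≤ emeryCellPressure β (emeryLine cuprateSigns (emeryLineCoords (((-31/4 : ℚ)) : ℝ) p))) emeryBoxNdNiO2Dxy459YK26 := by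
  intro p hp
  refine le_trans ?_ (emeryBoxNdNiO2Dxy459YK26_pressureFloorFam_m31o4 hβ p hp)
  refine div_le_div_of_nonneg_right ?_ (by norm_num)
  have hk : Real.log 2 - β * (-12673781/125000 : ℝ) = Real.log (2 * Real.exp (-(β * (-12673781/125000 : ℝ)))) := by
    rw [Real.log_mul (by norm_num) (Real.exp_pos _).ne', Real.log_exp]; ring
  rw [hk]
  refine Real.log_le_log (by positivity) ?_
  have e := fun (c : ℝ) (hc : c ≤ (-12673781/125000 : ℝ)) => Real.exp_le_exp.2 (neg_le_neg (mul_le_mul_of_nonneg_left hc hβ))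
  nlinarith [e (-25541949/250000 : ℝ) (by norm_num), e (-12673781/125000 : ℝ) (by norm_num)]

/-! ### Sr₀.₉La₀.₁CuO₂ (#37) cGW-SIC CLASS six-box (electron-doped, n_holes 0.9) — level εp = -48/5 (μ = 48/5 eV): best family `c0ll` (members N = 20, 21) -/

/-- Closed-form box bound of member 0 (`kry_SLCO_c0ll_s10x10`, N = 20) of the family at εp = -48/5: `≤ -134670811/1000000` (-134.670811; cluster units, 4 cells). [folklore] -/
theorem sLCOFam_c0ll_m48o5_cap0 :
    affineCapBound cuprateSigns (fun a => ((kryFam_SLCO_c0ll_S 0 a : ℤ) : ℝ) / ((kryFam_SLCO_c0ll_NN 0 : ℤ) : ℝ)) (emeryLo (-48/5) slcoClassEmery_tpd slcoClassEmery_tpp slcoClassEmery_Delta slcoClassEmery_Udd slcoClassEmery_Upp) (emeryHi (-48/5) slcoClassEmery_tpd slcoClassEmery_tpp slcoClassEmery_Delta slcoClassEmery_Udd slcoClassEmery_Upp) ≤ (-134670811/1000000 : ℝ) := by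
  simp only [kryFam_SLCO_c0ll_S, kryFam_SLCO_c0ll_NN, affineCapBound, emeryLo, emeryHi, lineCoeff, kry_SLCO_c0ll_s10x10_S, cuprateSigns, slcoClassEmery_tpd, slcoClassEmery_tpp, slcoClassEmery_Delta, slcoClassEmery_Udd, slcoClassEmery_Upp,
    Entry.encl_ofEnds_fst, Entry.encl_ofEnds_snd, Fin.sum_univ_succ, Fin.sum_univ_zero,
    Matrix.cons_val_zero, Matrix.cons_val_one, Matrix.cons_val_two, Matrix.cons_val, Matrix.head_cons, Matrix.tail_cons]
  push_cast
  norm_num [max_def]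

/-- Closed-form box bound of member 1 (`kry_SLCO_c0ll_s10x11`, N = 21) of the family at εp = -48/5: `≤ -65789929/500000` (-131.579858; cluster units, 4 cells). [folklore] -/
theorem sLCOFam_c0ll_m48o5_cap1 :
    affineCapBound cuprateSigns (fun a => ((kryFam_SLCO_c0ll_S 1 a : ℤ) : ℝ) / ((kryFam_SLCO_c0ll_NN 1 : ℤ) : ℝ)) (emeryLo (-48/5) slcoClassEmery_tpd slcoClassEmery_tpp slcoClassEmery_Delta slcoClassEmery_Udd slcoClassEmery_Upp) (emeryHi (-48/5) slcoClassEmery_tpd slcoClassEmery_tpp slcoClassEmery_Delta slcoClassEmery_Udd slcoClassEmery_Upp) ≤ (-65789929/500000 : ℝ) := by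
  simp only [kryFam_SLCO_c0ll_S, kryFam_SLCO_c0ll_NN, affineCapBound, emeryLo, emeryHi, lineCoeff, kry_SLCO_c0ll_s10x11_S, cuprateSigns, slcoClassEmery_tpd, slcoClassEmery_tpp, slcoClassEmery_Delta, slcoClassEmery_Udd, slcoClassEmery_Upp,
    Entry.encl_ofEnds_fst, Entry.encl_ofEnds_snd, Fin.sum_univ_succ, Fin.sum_univ_zero,
    Matrix.cons_val_zero, Matrix.cons_val_one, Matrix.cons_val_two, Matrix.cons_val, Matrix.head_cons, Matrix.tail_cons]
  push_cast
  norm_num [max_def]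

/-- **`T > 0` FAMILY FLOOR** on the whole `emeryBoxSLCOClass`, cuprate signs, level εp = -48/5, EVERY β ≥ 0:
`¼·log(Σᵢ exp(−β·Cᵢ)) ≤ P_cell(β, θ_εp(p))` with `C = (-134670811/1000000, -65789929/500000)` = the closed-form box bounds of the 2 orthonormal members
(sectors N = 20, 21) of hubbard-box-p2's KLDL-R family `kryFam_SLCO_c0ll` — the log-sum-exp keeps the ENTROPY of the 2 sectors.
[cite: Ruelle1969, §2.5–2.6] [cite: Israel1979, Lemma II.3.1] -/
theorem emeryBoxSLCOClass_pressureFloorFam_m48o5 {β : ℝ} (hβ : 0 ≤ β) :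
    HoldsOn (fun p : EmeryCoord → ℝ =>
      Real.log (Real.exp (-(β * (-134670811/1000000 : ℝ))) + Real.exp (-(β * (-65789929/500000 : ℝ)))) / 4 ≤ emeryCellPressure β (emeryLine cuprateSigns (emeryLineCoords (((-48/5 : ℚ)) : ℝ) p))) emeryBoxSLCOClass := by
  have h := holdsOn_emeryCellPressureFloor_of_rayleighTraces (E := emeryBoxSLCOClass) (εp := -48/5) (eA := slcoClassEmery_tpd) (eB := slcoClassEmery_tpp) (eD := slcoClassEmery_Delta)
    (eUd := slcoClassEmery_Udd) (eUp := slcoClassEmery_Upp) rfl rfl rfl rfl rfl cuprateSigns hβ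
    (φ := fun i => ((kryFam_SLCO_c0ll i).unit : Fock (Orb (Fin 1 ×ₗ Fin 12)))) kryFam_SLCO_c0ll_orthonormal
    (T := fun i a => ((kryFam_SLCO_c0ll_S i a : ℤ) : ℝ) / ((kryFam_SLCO_c0ll_NN i : ℤ) : ℝ)) kryFam_SLCO_c0ll_traces
  intro p hp
  have h' := h p hp
  simp only [Fin.sum_univ_two] at h'
  refine le_trans ?_ h'
  exact div_le_div_of_nonneg_right (Real.log_le_log (by positivity) (add_le_add (Real.exp_le_exp.2 (neg_le_neg (mul_le_mul_of_nonneg_left sLCOFam_c0ll_m48o5_cap0 hβ))) (Real.exp_le_exp.2 (neg_le_neg (mul_le_mul_of_nonneg_left sLCOFam_c0ll_m48o5_cap1 hβ))))) (by norm_num)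

/-- **Entropy corollary** (all 2 sectors at the worst bound): `(log 2 − β·(-65789929/500000))/4 ≤ P_cell` on the whole box, every β ≥ 0 — at β = 0 this is the exact
count `¼·log 2` of the family. [cite: Ruelle1969, §2.5–2.6] -/
theorem emeryBoxSLCOClass_pressureFloorFam_m48o5_entropy {β : ℝ} (hβ : 0 ≤ β) :
    HoldsOn (fun p : EmeryCoord → ℝ =>
      (Real.log 2 - β * (-65789929/500000 : ℝ)) / 4 ≤ emeryCellPressure β (emeryLine cuprateSigns (emeryLineCoords (((-48/5 : ℚ)) : ℝ) p))) emeryBoxSLCOClass := by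
  intro p hp
  refine le_trans ?_ (emeryBoxSLCOClass_pressureFloorFam_m48o5 hβ p hp)
  refine div_le_div_of_nonneg_right ?_ (by norm_num)
  have hk : Real.log 2 - β * (-65789929/500000 : ℝ) = Real.log (2 * Real.exp (-(β * (-65789929/500000 : ℝ)))) := by
    rw [Real.log_mul (by norm_num) (Real.exp_pos _).ne', Real.log_exp]; ring
  rw [hk]
  refine Real.log_le_log (by positivity) ?_
  have e := fun (c : ℝ) (hc : c ≤ (-65789929/500000 : ℝ)) => Real.exp_le_exp.2 (neg_le_neg (mul_le_mul_of_nonneg_left hc hβ))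
  nlinarith [e (-134670811/1000000 : ℝ) (by norm_num), e (-65789929/500000 : ℝ) (by norm_num)]

/-! ### Sr₀.₉La₀.₁CuO₂ (#37) cGW-SIC CLASS six-box (electron-doped, n_holes 0.9) — level εp = -31/4 (μ = 31/4 eV): best family `c0ll` (members N = 20, 21) -/

/-- Closed-form box bound of member 0 (`kry_SLCO_c0ll_s10x10`, N = 20) of the family at εp = -31/4: `≤ -97670811/1000000` (-97.670811; cluster units, 4 cells). [folklore] -/
theorem sLCOFam_c0ll_m31o4_cap0 :
    affineCapBound cuprateSigns (fun a => ((kryFam_SLCO_c0ll_S 0 a : ℤ) : ℝ) / ((kryFam_SLCO_c0ll_NN 0 : ℤ) : ℝ)) (emeryLo (-31/4) slcoClassEmery_tpd slcoClassEmery_tpp slcoClassEmery_Delta slcoClassEmery_Udd slcoClassEmery_Upp) (emeryHi (-31/4) slcoClassEmery_tpd slcoClassEmery_tpp slcoClassEmery_Delta slcoClassEmery_Udd slcoClassEmery_Upp) ≤ (-97670811/1000000 : ℝ) := by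
  simp only [kryFam_SLCO_c0ll_S, kryFam_SLCO_c0ll_NN, affineCapBound, emeryLo, emeryHi, lineCoeff, kry_SLCO_c0ll_s10x10_S, cuprateSigns, slcoClassEmery_tpd, slcoClassEmery_tpp, slcoClassEmery_Delta, slcoClassEmery_Udd, slcoClassEmery_Upp,
    Entry.encl_ofEnds_fst, Entry.encl_ofEnds_snd, Fin.sum_univ_succ, Fin.sum_univ_zero,
    Matrix.cons_val_zero, Matrix.cons_val_one, Matrix.cons_val_two, Matrix.cons_val, Matrix.head_cons, Matrix.tail_cons]
  push_cast
  norm_num [max_def]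

/-- Closed-form box bound of member 1 (`kry_SLCO_c0ll_s10x11`, N = 21) of the family at εp = -31/4: `≤ -46364929/500000` (-92.729858; cluster units, 4 cells). [folklore] -/
theorem sLCOFam_c0ll_m31o4_cap1 :
    affineCapBound cuprateSigns (fun a => ((kryFam_SLCO_c0ll_S 1 a : ℤ) : ℝ) / ((kryFam_SLCO_c0ll_NN 1 : ℤ) : ℝ)) (emeryLo (-31/4) slcoClassEmery_tpd slcoClassEmery_tpp slcoClassEmery_Delta slcoClassEmery_Udd slcoClassEmery_Upp) (emeryHi (-31/4) slcoClassEmery_tpd slcoClassEmery_tpp slcoClassEmery_Delta slcoClassEmery_Udd slcoClassEmery_Upp) ≤ (-46364929/500000 : ℝ) := by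
  simp only [kryFam_SLCO_c0ll_S, kryFam_SLCO_c0ll_NN, affineCapBound, emeryLo, emeryHi, lineCoeff, kry_SLCO_c0ll_s10x11_S, cuprateSigns, slcoClassEmery_tpd, slcoClassEmery_tpp, slcoClassEmery_Delta, slcoClassEmery_Udd, slcoClassEmery_Upp,
    Entry.encl_ofEnds_fst, Entry.encl_ofEnds_snd, Fin.sum_univ_succ, Fin.sum_univ_zero,
    Matrix.cons_val_zero, Matrix.cons_val_one, Matrix.cons_val_two, Matrix.cons_val, Matrix.head_cons, Matrix.tail_cons]
  push_cast
  norm_num [max_def]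

/-- **`T > 0` FAMILY FLOOR** on the whole `emeryBoxSLCOClass`, cuprate signs, level εp = -31/4, EVERY β ≥ 0:
`¼·log(Σᵢ exp(−β·Cᵢ)) ≤ P_cell(β, θ_εp(p))` with `C = (-97670811/1000000, -46364929/500000)` = the closed-form box bounds of the 2 orthonormal members
(sectors N = 20, 21) of hubbard-box-p2's KLDL-R family `kryFam_SLCO_c0ll` — the log-sum-exp keeps the ENTROPY of the 2 sectors.
[cite: Ruelle1969, §2.5–2.6] [cite: Israel1979, Lemma II.3.1] -/
theorem emeryBoxSLCOClass_pressureFloorFam_m31o4 {β : ℝ} (hβ : 0 ≤ β) :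
    HoldsOn (fun p : EmeryCoord → ℝ =>
      Real.log (Real.exp (-(β * (-97670811/1000000 : ℝ))) + Real.exp (-(β * (-46364929/500000 : ℝ)))) / 4 ≤ emeryCellPressure β (emeryLine cuprateSigns (emeryLineCoords (((-31/4 : ℚ)) : ℝ) p))) emeryBoxSLCOClass := by
  have h := holdsOn_emeryCellPressureFloor_of_rayleighTraces (E := emeryBoxSLCOClass) (εp := -31/4) (eA := slcoClassEmery_tpd) (eB := slcoClassEmery_tpp) (eD := slcoClassEmery_Delta)
    (eUd := slcoClassEmery_Udd) (eUp := slcoClassEmery_Upp) rfl rfl rfl rfl rfl cuprateSigns hβ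
    (φ := fun i => ((kryFam_SLCO_c0ll i).unit : Fock (Orb (Fin 1 ×ₗ Fin 12)))) kryFam_SLCO_c0ll_orthonormal
    (T := fun i a => ((kryFam_SLCO_c0ll_S i a : ℤ) : ℝ) / ((kryFam_SLCO_c0ll_NN i : ℤ) : ℝ)) kryFam_SLCO_c0ll_traces
  intro p hp
  have h' := h p hp
  simp only [Fin.sum_univ_two] at h'
  refine le_trans ?_ h'
  exact div_le_div_of_nonneg_right (Real.log_le_log (by positivity) (add_le_add (Real.exp_le_exp.2 (neg_le_neg (mul_le_mul_of_nonneg_left sLCOFam_c0ll_m31o4_cap0 hβ))) (Real.exp_le_exp.2 (neg_le_neg (mul_le_mul_of_nonneg_left sLCOFam_c0ll_m31o4_cap1 hβ))))) (by norm_num)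

/-- **Entropy corollary** (all 2 sectors at the worst bound): `(log 2 − β·(-46364929/500000))/4 ≤ P_cell` on the whole box, every β ≥ 0 — at β = 0 this is the exact
count `¼·log 2` of the family. [cite: Ruelle1969, §2.5–2.6] -/
theorem emeryBoxSLCOClass_pressureFloorFam_m31o4_entropy {β : ℝ} (hβ : 0 ≤ β) :
    HoldsOn (fun p : EmeryCoord → ℝ =>
      (Real.log 2 - β * (-46364929/500000 : ℝ)) / 4 ≤ emeryCellPressure β (emeryLine cuprateSigns (emeryLineCoords (((-31/4 : ℚ)) : ℝ) p))) emeryBoxSLCOClass := by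
  intro p hp
  refine le_trans ?_ (emeryBoxSLCOClass_pressureFloorFam_m31o4 hβ p hp)
  refine div_le_div_of_nonneg_right ?_ (by norm_num)
  have hk : Real.log 2 - β * (-46364929/500000 : ℝ) = Real.log (2 * Real.exp (-(β * (-46364929/500000 : ℝ)))) := by
    rw [Real.log_mul (by norm_num) (Real.exp_pos _).ne', Real.log_exp]; ring
  rw [hk]
  refine Real.log_le_log (by positivity) ?_
  have e := fun (c : ℝ) (hc : c ≤ (-46364929/500000 : ℝ)) => Real.exp_le_exp.2 (neg_le_neg (mul_le_mul_of_nonneg_left hc hβ))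
  nlinarith [e (-97670811/1000000 : ℝ) (by norm_num), e (-46364929/500000 : ℝ) (by norm_num)]

/-! ### HgBa₂Ca₂Cu₃O₈ (#35) inner plane, site-mean filling — level εp = -48/5 (μ = 48/5 eV): best family `c0ll` (members N = 19, 20) -/

/-- Closed-form box bound of member 0 (`kry_Hg1223IP_c0ll_s9x10`, N = 19) of the family at εp = -48/5: `≤ -71580557/500000` (-143.161114; cluster units, 4 cells). [folklore] -/
theorem hg1223IPFam_c0ll_m48o5_cap0 :
    affineCapBound cuprateSigns (fun a => ((kryFam_Hg1223IP_c0ll_S 0 a : ℤ) : ℝ) / ((kryFam_Hg1223IP_c0ll_NN 0 : ℤ) : ℝ)) (emeryLo (-48/5) hg1223IPEmery_tpd hg1223IPEmery_tpp hg1223IPEmery_Delta hg1223Emery_Udd hg1223Emery_Upp) (emeryHi (-48/5) hg1223IPEmery_tpd hg1223IPEmery_tpp hg1223IPEmery_Delta hg1223Emery_Udd hg1223Emery_Upp) ≤ (-71580557/500000 : ℝ) := by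
  simp only [kryFam_Hg1223IP_c0ll_S, kryFam_Hg1223IP_c0ll_NN, affineCapBound, emeryLo, emeryHi, lineCoeff, kry_Hg1223IP_c0ll_s9x10_S, cuprateSigns, hg1223IPEmery_tpd, hg1223IPEmery_tpp, hg1223IPEmery_Delta, hg1223Emery_Udd, hg1223Emery_Upp,
    Entry.encl_ofEnds_fst, Entry.encl_ofEnds_snd, Fin.sum_univ_succ, Fin.sum_univ_zero,
    Matrix.cons_val_zero, Matrix.cons_val_one, Matrix.cons_val_two, Matrix.cons_val, Matrix.head_cons, Matrix.tail_cons]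
  push_cast
  norm_num [max_def]

/-- Closed-form box bound of member 1 (`kry_Hg1223IP_c0ll_s10x10`, N = 20) of the family at εp = -48/5: `≤ -36100451/250000` (-144.401804; cluster units, 4 cells). [folklore] -/
theorem hg1223IPFam_c0ll_m48o5_cap1 :
    affineCapBound cuprateSigns (fun a => ((kryFam_Hg1223IP_c0ll_S 1 a : ℤ) : ℝ) / ((kryFam_Hg1223IP_c0ll_NN 1 : ℤ) : ℝ)) (emeryLo (-48/5) hg1223IPEmery_tpd hg1223IPEmery_tpp hg1223IPEmery_Delta hg1223Emery_Udd hg1223Emery_Upp) (emeryHi (-48/5) hg1223IPEmery_tpd hg1223IPEmery_tpp hg1223IPEmery_Delta hg1223Emery_Udd hg1223Emery_Upp) ≤ (-36100451/250000 : ℝ) := by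
  simp only [kryFam_Hg1223IP_c0ll_S, kryFam_Hg1223IP_c0ll_NN, affineCapBound, emeryLo, emeryHi, lineCoeff, kry_Hg1223IP_c0ll_s10x10_S, cuprateSigns, hg1223IPEmery_tpd, hg1223IPEmery_tpp, hg1223IPEmery_Delta, hg1223Emery_Udd, hg1223Emery_Upp,
    Entry.encl_ofEnds_fst, Entry.encl_ofEnds_snd, Fin.sum_univ_succ, Fin.sum_univ_zero,
    Matrix.cons_val_zero, Matrix.cons_val_one, Matrix.cons_val_two, Matrix.cons_val, Matrix.head_cons, Matrix.tail_cons]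
  push_cast
  norm_num [max_def]

/-- **`T > 0` FAMILY FLOOR** on the whole `emeryBoxHg1223IP`, cuprate signs, level εp = -48/5, EVERY β ≥ 0:
`¼·log(Σᵢ exp(−β·Cᵢ)) ≤ P_cell(β, θ_εp(p))` with `C = (-71580557/500000, -36100451/250000)` = the closed-form box bounds of the 2 orthonormal members
(sectors N = 19, 20) of hubbard-box-p2's KLDL-R family `kryFam_Hg1223IP_c0ll` — the log-sum-exp keeps the ENTROPY of the 2 sectors.
[cite: Ruelle1969, §2.5–2.6] [cite: Israel1979, Lemma II.3.1] -/
theorem emeryBoxHg1223IP_pressureFloorFam_m48o5 {β : ℝ} (hβ : 0 ≤ β) :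
    HoldsOn (fun p : EmeryCoord → ℝ =>
      Real.log (Real.exp (-(β * (-71580557/500000 : ℝ))) + Real.exp (-(β * (-36100451/250000 : ℝ)))) / 4 ≤ emeryCellPressure β (emeryLine cuprateSigns (emeryLineCoords (((-48/5 : ℚ)) : ℝ) p))) emeryBoxHg1223IP := by
  have h := holdsOn_emeryCellPressureFloor_of_rayleighTraces (E := emeryBoxHg1223IP) (εp := -48/5) (eA := hg1223IPEmery_tpd) (eB := hg1223IPEmery_tpp) (eD := hg1223IPEmery_Delta)
    (eUd := hg1223Emery_Udd) (eUp := hg1223Emery_Upp) rfl rfl rfl rfl rfl cuprateSigns hβ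
    (φ := fun i => ((kryFam_Hg1223IP_c0ll i).unit : Fock (Orb (Fin 1 ×ₗ Fin 12)))) kryFam_Hg1223IP_c0ll_orthonormal
    (T := fun i a => ((kryFam_Hg1223IP_c0ll_S i a : ℤ) : ℝ) / ((kryFam_Hg1223IP_c0ll_NN i : ℤ) : ℝ)) kryFam_Hg1223IP_c0ll_traces
  intro p hp
  have h' := h p hp
  simp only [Fin.sum_univ_two] at h'
  refine le_trans ?_ h'
  exact div_le_div_of_nonneg_right (Real.log_le_log (by positivity) (add_le_add (Real.exp_le_exp.2 (neg_le_neg (mul_le_mul_of_nonneg_left hg1223IPFam_c0ll_m48o5_cap0 hβ))) (Real.exp_le_exp.2 (neg_le_neg (mul_le_mul_of_nonneg_left hg1223IPFam_c0ll_m48o5_cap1 hβ))))) (by norm_num)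

/-- **Entropy corollary** (all 2 sectors at the worst bound): `(log 2 − β·(-71580557/500000))/4 ≤ P_cell` on the whole box, every β ≥ 0 — at β = 0 this is the exact
count `¼·log 2` of the family. [cite: Ruelle1969, §2.5–2.6] -/
theorem emeryBoxHg1223IP_pressureFloorFam_m48o5_entropy {β : ℝ} (hβ : 0 ≤ β) :
    HoldsOn (fun p : EmeryCoord → ℝ =>
      (Real.log 2 - β * (-71580557/500000 : ℝ)) / 4 ≤ emeryCellPressure β (emeryLine cuprateSigns (emeryLineCoords (((-48/5 : ℚ)) : ℝ) p))) emeryBoxHg1223IP := by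
  intro p hp
  refine le_trans ?_ (emeryBoxHg1223IP_pressureFloorFam_m48o5 hβ p hp)
  refine div_le_div_of_nonneg_right ?_ (by norm_num)
  have hk : Real.log 2 - β * (-71580557/500000 : ℝ) = Real.log (2 * Real.exp (-(β * (-71580557/500000 : ℝ)))) := by
    rw [Real.log_mul (by norm_num) (Real.exp_pos _).ne', Real.log_exp]; ring
  rw [hk]
  refine Real.log_le_log (by positivity) ?_
  have e := fun (c : ℝ) (hc : c ≤ (-71580557/500000 : ℝ)) => Real.exp_le_exp.2 (neg_le_neg (mul_le_mul_of_nonneg_left hc hβ))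
  nlinarith [e (-71580557/500000 : ℝ) (by norm_num), e (-36100451/250000 : ℝ) (by norm_num)]

/-! ### HgBa₂Ca₂Cu₃O₈ (#35) inner plane, site-mean filling — level εp = -31/4 (μ = 31/4 eV): best family `c0ll` (members N = 19, 20) -/

/-- Closed-form box bound of member 0 (`kry_Hg1223IP_c0ll_s9x10`, N = 19) of the family at εp = -31/4: `≤ -54005557/500000` (-108.011114; cluster units, 4 cells). [folklore] -/
theorem hg1223IPFam_c0ll_m31o4_cap0 :
    affineCapBound cuprateSigns (fun a => ((kryFam_Hg1223IP_c0ll_S 0 a : ℤ) : ℝ) / ((kryFam_Hg1223IP_c0ll_NN 0 : ℤ) : ℝ)) (emeryLo (-31/4) hg1223IPEmery_tpd hg1223IPEmery_tpp hg1223IPEmery_Delta hg1223Emery_Udd hg1223Emery_Upp) (emeryHi (-31/4) hg1223IPEmery_tpd hg1223IPEmery_tpp hg1223IPEmery_Delta hg1223Emery_Udd hg1223Emery_Upp) ≤ (-54005557/500000 : ℝ) := by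
  simp only [kryFam_Hg1223IP_c0ll_S, kryFam_Hg1223IP_c0ll_NN, affineCapBound, emeryLo, emeryHi, lineCoeff, kry_Hg1223IP_c0ll_s9x10_S, cuprateSigns, hg1223IPEmery_tpd, hg1223IPEmery_tpp, hg1223IPEmery_Delta, hg1223Emery_Udd, hg1223Emery_Upp,
    Entry.encl_ofEnds_fst, Entry.encl_ofEnds_snd, Fin.sum_univ_succ, Fin.sum_univ_zero,
    Matrix.cons_val_zero, Matrix.cons_val_one, Matrix.cons_val_two, Matrix.cons_val, Matrix.head_cons, Matrix.tail_cons]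
  push_cast
  norm_num [max_def]

/-- Closed-form box bound of member 1 (`kry_Hg1223IP_c0ll_s10x10`, N = 20) of the family at εp = -31/4: `≤ -26850451/250000` (-107.401804; cluster units, 4 cells). [folklore] -/
theorem hg1223IPFam_c0ll_m31o4_cap1 :
    affineCapBound cuprateSigns (fun a => ((kryFam_Hg1223IP_c0ll_S 1 a : ℤ) : ℝ) / ((kryFam_Hg1223IP_c0ll_NN 1 : ℤ) : ℝ)) (emeryLo (-31/4) hg1223IPEmery_tpd hg1223IPEmery_tpp hg1223IPEmery_Delta hg1223Emery_Udd hg1223Emery_Upp) (emeryHi (-31/4) hg1223IPEmery_tpd hg1223IPEmery_tpp hg1223IPEmery_Delta hg1223Emery_Udd hg1223Emery_Upp) ≤ (-26850451/250000 : ℝ) := by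
  simp only [kryFam_Hg1223IP_c0ll_S, kryFam_Hg1223IP_c0ll_NN, affineCapBound, emeryLo, emeryHi, lineCoeff, kry_Hg1223IP_c0ll_s10x10_S, cuprateSigns, hg1223IPEmery_tpd, hg1223IPEmery_tpp, hg1223IPEmery_Delta, hg1223Emery_Udd, hg1223Emery_Upp,
    Entry.encl_ofEnds_fst, Entry.encl_ofEnds_snd, Fin.sum_univ_succ, Fin.sum_univ_zero,
    Matrix.cons_val_zero, Matrix.cons_val_one, Matrix.cons_val_two, Matrix.cons_val, Matrix.head_cons, Matrix.tail_cons]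
  push_cast
  norm_num [max_def]

/-- **`T > 0` FAMILY FLOOR** on the whole `emeryBoxHg1223IP`, cuprate signs, level εp = -31/4, EVERY β ≥ 0:
`¼·log(Σᵢ exp(−β·Cᵢ)) ≤ P_cell(β, θ_εp(p))` with `C = (-54005557/500000, -26850451/250000)` = the closed-form box bounds of the 2 orthonormal members
(sectors N = 19, 20) of hubbard-box-p2's KLDL-R family `kryFam_Hg1223IP_c0ll` — the log-sum-exp keeps the ENTROPY of the 2 sectors.
[cite: Ruelle1969, §2.5–2.6] [cite: Israel1979, Lemma II.3.1] -/
theorem emeryBoxHg1223IP_pressureFloorFam_m31o4 {β : ℝ} (hβ : 0 ≤ β) :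
    HoldsOn (fun p : EmeryCoord → ℝ =>
      Real.log (Real.exp (-(β * (-54005557/500000 : ℝ))) + Real.exp (-(β * (-26850451/250000 : ℝ)))) / 4 ≤ emeryCellPressure β (emeryLine cuprateSigns (emeryLineCoords (((-31/4 : ℚ)) : ℝ) p))) emeryBoxHg1223IP := by
  have h := holdsOn_emeryCellPressureFloor_of_rayleighTraces (E := emeryBoxHg1223IP) (εp := -31/4) (eA := hg1223IPEmery_tpd) (eB := hg1223IPEmery_tpp) (eD := hg1223IPEmery_Delta)
    (eUd := hg1223Emery_Udd) (eUp := hg1223Emery_Upp) rfl rfl rfl rfl rfl cuprateSigns hβ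
    (φ := fun i => ((kryFam_Hg1223IP_c0ll i).unit : Fock (Orb (Fin 1 ×ₗ Fin 12)))) kryFam_Hg1223IP_c0ll_orthonormal
    (T := fun i a => ((kryFam_Hg1223IP_c0ll_S i a : ℤ) : ℝ) / ((kryFam_Hg1223IP_c0ll_NN i : ℤ) : ℝ)) kryFam_Hg1223IP_c0ll_traces
  intro p hp
  have h' := h p hp
  simp only [Fin.sum_univ_two] at h'
  refine le_trans ?_ h'
  exact div_le_div_of_nonneg_right (Real.log_le_log (by positivity) (add_le_add (Real.exp_le_exp.2 (neg_le_neg (mul_le_mul_of_nonneg_left hg1223IPFam_c0ll_m31o4_cap0 hβ))) (Real.exp_le_exp.2 (neg_le_neg (mul_le_mul_of_nonneg_left hg1223IPFam_c0ll_m31o4_cap1 hβ))))) (by norm_num)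

/-- **Entropy corollary** (all 2 sectors at the worst bound): `(log 2 − β·(-26850451/250000))/4 ≤ P_cell` on the whole box, every β ≥ 0 — at β = 0 this is the exact
count `¼·log 2` of the family. [cite: Ruelle1969, §2.5–2.6] -/
theorem emeryBoxHg1223IP_pressureFloorFam_m31o4_entropy {β : ℝ} (hβ : 0 ≤ β) :
    HoldsOn (fun p : EmeryCoord → ℝ =>
      (Real.log 2 - β * (-26850451/250000 : ℝ)) / 4 ≤ emeryCellPressure β (emeryLine cuprateSigns (emeryLineCoords (((-31/4 : ℚ)) : ℝ) p))) emeryBoxHg1223IP := by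
  intro p hp
  refine le_trans ?_ (emeryBoxHg1223IP_pressureFloorFam_m31o4 hβ p hp)
  refine div_le_div_of_nonneg_right ?_ (by norm_num)
  have hk : Real.log 2 - β * (-26850451/250000 : ℝ) = Real.log (2 * Real.exp (-(β * (-26850451/250000 : ℝ)))) := by
    rw [Real.log_mul (by norm_num) (Real.exp_pos _).ne', Real.log_exp]; ring
  rw [hk]
  refine Real.log_le_log (by positivity) ?_
  have e := fun (c : ℝ) (hc : c ≤ (-26850451/250000 : ℝ)) => Real.exp_le_exp.2 (neg_le_neg (mul_le_mul_of_nonneg_left hc hβ))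
  nlinarith [e (-54005557/500000 : ℝ) (by norm_num), e (-26850451/250000 : ℝ) (by norm_num)]

end Summit.Ventures.CertifiedManyBodySolver.Downfold

end
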